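import Mathlib
import HarnessLib
import Literature.MathematicalPhysics.QuantumLattice.GaugeGroups
import Summits.Ventures.LatticeQCDFlow.Exactness.HaarSteinSpecialUnitary
import Summits.Ventures.LatticeQCDFlow.Exactness.CabibboMarinariQuat

/-!
# The `a₀` law of the SU(2) link weight: a Stein identity (reference-free check of the heat bath's `a₀` step)

HONEST FRAMING: exact (Metropolis-corrected) sampling algorithms for lattice gauge theory;
figures of merit are autocorrelation/cost numbers at stated couplings and volumes; no
continuum-physics claim.

Venture `LatticeQCDFlow` (cell pub-lqcd), topic `Exactness`, FANOUT row 9 (eng-latcore; the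
engine's SU(2) heat bath — Kennedy–Pendleton / Creutz — draws `a₀ = Re tr U / 2` from the density
`∝ √(1 − a₀²) e^{βk a₀}`, acceptance test A3 checks it by a 40-bin histogram).  NEW WORK of the cell
over Mathlib, `HaarStein*.lean` (`gibbs_stein`, the SU(n) exp-curve) and `CabibboMarinariQuat.lean`
(`|a|² + |b|² = 1` on SU(2)); nothing is cited as a fact.

The √(1 − a₀²) factor is the Haar marginal of `a₀` on SU(2) (≅ the 3-sphere) — "used, not typed"
in `TYPED-EXACTNESS-MAP.md`.  Short of typing that marginal (surface measure of S³), this file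
types the IDENTITY that pins it down: for the one-link law `e^{c a₀(U)} dHaar_SU(2)(U)` (`c = βk`)
and every bounded `C¹` test function `ψ` with bounded derivative,

  `∫ [ (1 − a₀²)(ψ′(a₀) + c ψ(a₀)) − 3 a₀ ψ(a₀) ] e^{c a₀} dHaar(U) = 0`   (`su2_a0_stein`),

which is exactly the integration-by-parts identity of the density `(1 − t²)^{1/2} e^{ct}` on
`[−1, 1]` (`((1−t²)^{3/2} e^{ct})′ = [c(1−t²) − 3t](1−t²)^{1/2} e^{ct}`), and determines all moments
of the `a₀` law recursively (ψ = t^k).  With `ψ = 1`: **`3 ⟨a₀⟩ = c ⟨1 − a₀²⟩`** (`su2_a0_mean`) — a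
reference-free, histogram-free check of the `a₀` sampler at every `βk`, the `N = 2` analogue of the
Schwinger–Dyson residual.  Proof: `gibbs_stein` along `exp(tZ_a)` for the three quaternion
generators `Z₁ = iσ₁, Z₂ = iσ₂, Z₃ = iσ₃` (`Z_a² = −1`) with observables `x_a ψ(a₀)`, summed using
`a₀² + x₁² + x₂² + x₃² = 1` on SU(2).

Not here: that the `a₀` marginal IS `(2/π)√(1 − t²) dt` (moment determinacy / surface measure), the
Kennedy–Pendleton proposal law, floating point.
-/

namespace Summit.Ventures.LatticeQCDFlow.Exactness

open Matrix NormedSpace MeasureTheory Metric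
open scoped Topology

/-! ## §1 Quaternion coordinates on SU(2) -/

/-- `a₀(U) = Re tr U / 2`. -/
noncomputable def su2a0 (U : Matrix.specialUnitaryGroup (Fin 2) ℂ) : ℝ :=
  (((U : Matrix (Fin 2) (Fin 2) ℂ)).trace).re / 2

/-- The coordinate along a generator: `x_Z(U) = −Re tr (Z U) / 2`. -/
noncomputable def su2x (Z : Matrix (Fin 2) (Fin 2) ℂ) (U : Matrix.specialUnitaryGroup (Fin 2) ℂ) : ℝ :=
  -(((Z * (U : Matrix (Fin 2) (Fin 2) ℂ)).trace).re) / 2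

/-- The three quaternion generators `iσ₁, iσ₂, iσ₃`. -/
def genZ1 : Matrix (Fin 2) (Fin 2) ℂ := !![0, Complex.I; Complex.I, 0]
/-- `iσ₂`. -/
def genZ2 : Matrix (Fin 2) (Fin 2) ℂ := !![0, 1; -1, 0]
/-- `iσ₃`. -/
def genZ3 : Matrix (Fin 2) (Fin 2) ℂ := !![Complex.I, 0; 0, -Complex.I]

/-- The generators are skew-Hermitian, traceless and square to `−1`. -/
theorem genZ1_props : genZ1ᴴ = -genZ1 ∧ genZ1.trace = 0 ∧ genZ1 * genZ1 = -1 := by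
  refine ⟨?_, ?_, ?_⟩
  · ext i j; fin_cases i <;> fin_cases j <;> simp [genZ1, Matrix.conjTranspose_apply]
  · simp [genZ1, Matrix.trace_fin_two]
  · ext i j; fin_cases i <;> fin_cases j <;> simp [genZ1, Matrix.mul_apply, Fin.sum_univ_two]

/-- … the same for `iσ₂` … -/
theorem genZ2_props : genZ2ᴴ = -genZ2 ∧ genZ2.trace = 0 ∧ genZ2 * genZ2 = -1 := by
  refine ⟨?_, ?_, ?_⟩
  · ext i j; fin_cases i <;> fin_cases j <;> simp [genZ2, Matrix.conjTranspose_apply]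
  · simp [genZ2, Matrix.trace_fin_two]
  · ext i j; fin_cases i <;> fin_cases j <;> simp [genZ2, Matrix.mul_apply, Fin.sum_univ_two]

/-- … and for `iσ₃`. -/
theorem genZ3_props : genZ3ᴴ = -genZ3 ∧ genZ3.trace = 0 ∧ genZ3 * genZ3 = -1 := by
  refine ⟨?_, ?_, ?_⟩
  · ext i j; fin_cases i <;> fin_cases j <;> simp [genZ3, Matrix.conjTranspose_apply]
  · simp [genZ3, Matrix.trace_fin_two]
  · ext i j; fin_cases i <;> fin_cases j <;> simp [genZ3, Matrix.mul_apply, Fin.sum_univ_two]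

/-- **Unit quaternion**: `a₀² + x₁² + x₂² + x₃² = 1` on SU(2). -/
theorem su2_sum_sq (U : Matrix.specialUnitaryGroup (Fin 2) ℂ) :
    su2a0 U ^ 2 + su2x genZ1 U ^ 2 + su2x genZ2 U ^ 2 + su2x genZ3 U ^ 2 = 1 := by
  have hq := IsQuat.of_mem_specialUnitaryGroup U.2
  have h1 := IsQuat.normSq_eq_one_of_mem U.2
  unfold IsQuat.normSq at h1
  rw [Complex.normSq_apply, Complex.normSq_apply] at h1
  simp only [su2a0, su2x, genZ1, genZ2, genZ3, Matrix.trace_fin_two, Matrix.mul_apply,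
    Fin.sum_univ_two, Matrix.of_apply, Matrix.cons_val', Matrix.cons_val_zero, Matrix.cons_val_one,
    Matrix.empty_val', Matrix.cons_val_fin_one, hq.diag, hq.offdiag, Complex.add_re, Complex.mul_re,
    Complex.I_re, Complex.I_im, Complex.conj_re, Complex.conj_im, Complex.neg_re, Complex.neg_im,
    Complex.one_re, Complex.one_im, Complex.zero_re, Complex.zero_im]
  nlinarith [h1]

/-! ## §2 One generator: the Haar–Stein identity for `x_Z ψ(a₀)` -/

/-- **One-generator identity.**  For the Haar probability `μ` of SU(2), a generator `Z` (skew-Hermitian,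
traceless, `Z² = −1`), a real `c`, and a bounded `C¹` test function `ψ` with bounded continuous
derivative `ψ′`:  `∫ [a₀ ψ(a₀) − x_Z² ψ′(a₀) − c x_Z² ψ(a₀)] e^{c a₀} dμ = 0`. -/
theorem su2_generator_stein (Z : Matrix (Fin 2) (Fin 2) ℂ) (hZ : Zᴴ = -Z) (hZ0 : Z.trace = 0)
    (hZZ : Z * Z = -1) (c : ℝ) {ψ ψ' : ℝ → ℝ} (hψ : ∀ x, HasDerivAt ψ (ψ' x) x)
    (hψ'c : Continuous ψ') {K : ℝ} (hK : ∀ x, |ψ x| ≤ K) (hK' : ∀ x, |ψ' x| ≤ K) :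
    ∫ U, (su2a0 U * ψ (su2a0 U) - su2x Z U ^ 2 * ψ' (su2a0 U) - c * su2x Z U ^ 2 * ψ (su2a0 U))
        * Real.exp (c * su2a0 U)
      ∂(Literature.MathematicalPhysics.QuantumFieldTheory.haarProbability
        (Matrix.specialUnitaryGroup (Fin 2) ℂ)) = 0 := by
  set μ := Literature.MathematicalPhysics.QuantumFieldTheory.haarProbability
    (Matrix.specialUnitaryGroup (Fin 2) ℂ)
  have hψc : Continuous ψ := continuous_iff_continuousAt.mpr fun x => (hψ x).continuousAt
  have hK0 : 0 ≤ K := le_trans (abs_nonneg _) (hK 0)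
  -- the curve
  have hγU : ∀ (t : ℝ) (U : Matrix.specialUnitaryGroup (Fin 2) ℂ),
      (↑(expCurveSU Z hZ hZ0 t * U) : Matrix (Fin 2) (Fin 2) ℂ)
        = exp (t • Z) * (U : Matrix (Fin 2) (Fin 2) ℂ) :=
    fun t U => by rw [Submonoid.coe_mul, coe_expCurveSU]
  have hcommZ : ∀ t : ℝ, exp (t • Z) * Z = Z * exp (t • Z) := fun t =>
    (((Commute.refl Z).smul_right t).exp_right).eq.symm
  have hZexp : ∀ (t : ℝ) (M : Matrix (Fin 2) (Fin 2) ℂ),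
      Z * exp (t • Z) * M = exp (t • Z) * (Z * M) := fun t M => by
    rw [← hcommZ t, Matrix.mul_assoc]
  have hZZU : ∀ (M : Matrix (Fin 2) (Fin 2) ℂ), Z * (Z * M) = -M := fun M => by
    rw [← Matrix.mul_assoc, hZZ, Matrix.neg_mul, Matrix.one_mul]
  -- unitary bounds
  have hVU : ∀ (t : ℝ) (U : Matrix.specialUnitaryGroup (Fin 2) ℂ),
      exp (t • Z) * (U : Matrix (Fin 2) (Fin 2) ℂ) ∈ Matrix.unitaryGroup (Fin 2) ℂ := fun t U => by
    rw [← hγU]; exact Matrix.specialUnitaryGroup_le_unitaryGroup (expCurveSU Z hZ hZ0 t * U).2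
  set βZ : ℝ := ∑ i : Fin 2, ∑ j : Fin 2, ‖Z i j‖ with hβZ
  set β1 : ℝ := ∑ i : Fin 2, ∑ j : Fin 2, ‖(1 : Matrix (Fin 2) (Fin 2) ℂ) i j‖ with hβ1
  have hβZ0 : 0 ≤ βZ := by positivity
  have hβ10 : 0 ≤ β1 := by positivity
  have bA : ∀ (t : ℝ) (U : Matrix.specialUnitaryGroup (Fin 2) ℂ),
      |((exp (t • Z) * (U : Matrix (Fin 2) (Fin 2) ℂ)).trace).re| ≤ β1 := fun t U => by
    have := abs_re_trace_mul_le_of_mem_unitaryGroup (hVU t U) 1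
    rwa [Matrix.mul_one] at this
  have bX : ∀ (t : ℝ) (U : Matrix.specialUnitaryGroup (Fin 2) ℂ),
      |((exp (t • Z) * (Z * (U : Matrix (Fin 2) (Fin 2) ℂ))).trace).re| ≤ βZ := fun t U => by
    rw [← Matrix.mul_assoc, hcommZ t, Matrix.mul_assoc, Matrix.trace_mul_comm]
    exact abs_re_trace_mul_le_of_mem_unitaryGroup (hVU t U) Z
  -- the constant
  set C : ℝ := (1 + |c|) * (K + 1) * (β1 + βZ + βZ * βZ + 1) with hC
  have hc0 : 0 ≤ |c| := abs_nonneg c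
  have hX0 : 0 ≤ β1 + βZ + βZ * βZ + 1 := by positivity
  have hABC : ∀ a b d : ℝ, 0 ≤ a → a ≤ 1 + |c| → 0 ≤ b → b ≤ K + 1 → 0 ≤ d →
      d ≤ β1 + βZ + βZ * βZ + 1 → a * b * d ≤ C := by
    intro a b d ha ha' hb hb' hd hd'
    rw [hC]
    exact mul_le_mul (mul_le_mul ha' hb' hb (by linarith)) hd' hd
      (mul_nonneg (by linarith) (by linarith))
  have hsq : 0 ≤ βZ * βZ := mul_self_nonneg βZ
  -- continuity helpers
  have ctr : ∀ M N : Matrix (Fin 2) (Fin 2) ℂ, Continuous fun U : Matrix.specialUnitaryGroup (Fin 2) ℂ =>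
      ((M * (N * (U : Matrix (Fin 2) (Fin 2) ℂ))).trace).re := fun M N =>
    Complex.continuous_re.comp ((continuous_const.matrix_mul
      (continuous_const.matrix_mul continuous_subtype_val)).matrix_trace)
  have ctr1 : ∀ M : Matrix (Fin 2) (Fin 2) ℂ, Continuous fun U : Matrix.specialUnitaryGroup (Fin 2) ℂ =>
      ((M * (U : Matrix (Fin 2) (Fin 2) ℂ)).trace).re := fun M =>
    Complex.continuous_re.comp ((continuous_const.matrix_mul continuous_subtype_val).matrix_trace)
  have ma0 : Continuous su2a0 := by
    unfold su2a0
    exact (Complex.continuous_re.comp (continuous_subtype_val.matrix_trace)).div_const _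
  have mx : Continuous (su2x Z) := by
    unfold su2x
    exact ((ctr1 Z).neg).div_const _
  -- apply the Haar–Stein identity
  have key := gibbs_stein (μ := μ) (γ := expCurveSU Z hZ hZ0) (ε := 1) (C := C)
    (h := fun U => su2x Z U * ψ (su2a0 U))
    (S := fun U => -(c * su2a0 U))
    (Dh := fun t U =>
      (-((Z * exp (t • Z) * (Z * (U : Matrix (Fin 2) (Fin 2) ℂ))).trace).re / 2)
        * ψ (((exp (t • Z) * (U : Matrix (Fin 2) (Fin 2) ℂ)).trace).re / 2)
      + (-((exp (t • Z) * (Z * (U : Matrix (Fin 2) (Fin 2) ℂ))).trace).re / 2)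
        * (ψ' (((exp (t • Z) * (U : Matrix (Fin 2) (Fin 2) ℂ)).trace).re / 2)
          * (((Z * exp (t • Z) * (U : Matrix (Fin 2) (Fin 2) ℂ)).trace).re / 2)))
    (DS := fun t U => -(c * (((Z * exp (t • Z) * (U : Matrix (Fin 2) (Fin 2) ℂ)).trace).re / 2)))
    one_pos (expCurveSU_zero hZ hZ0)
    (mx.mul (hψc.comp ma0)).measurable (ma0.measurable.const_mul c).neg ?_ ?_ ?_ ?_ ?_ ?_ ?_ ?_
  · -- conclusion
    have h0 : exp ((0 : ℝ) • Z) = 1 := by rw [zero_smul, NormedSpace.exp_zero]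
    refine Eq.trans (integral_congr_ae (Filter.Eventually.of_forall fun U => ?_)) key
    simp only [h0, Matrix.mul_one, Matrix.one_mul, hZZU, Matrix.trace_neg, Complex.neg_re]
    simp only [su2a0, su2x]
    ring
  · -- measurability of Dh 0
    simp only [zero_smul, NormedSpace.exp_zero, Matrix.mul_one, Matrix.one_mul]
    refine Continuous.measurable ?_
    refine Continuous.add (Continuous.mul (((ctr Z Z).neg).div_const 2) (hψc.comp' ma0))
      (Continuous.mul (((ctr1 Z).neg).div_const 2) (Continuous.mul (hψ'c.comp' ma0)
        ((ctr1 Z).div_const 2)))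
  · -- measurability of DS 0
    simp only [zero_smul, NormedSpace.exp_zero, Matrix.mul_one]
    exact ((((ctr1 Z).div_const 2).const_mul c).neg).measurable
  · -- derivative of h along the curve
    intro U t _
    have hAd : HasDerivAt (fun x : ℝ => ((exp (x • Z) * (U : Matrix (Fin 2) (Fin 2) ℂ)).trace).re / 2)
        ((((Z * exp (t • Z) * (U : Matrix (Fin 2) (Fin 2) ℂ)).trace).re) / 2) t :=
      (hasDerivAt_re_trace_exp_smul_mul Z (U : Matrix (Fin 2) (Fin 2) ℂ) t).div_const 2
    have hXd : HasDerivAt (fun x : ℝ => -((exp (x • Z) * (Z * (U : Matrix (Fin 2) (Fin 2) ℂ))).trace).re / 2)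
        (-(((Z * exp (t • Z) * (Z * (U : Matrix (Fin 2) (Fin 2) ℂ))).trace).re) / 2) t :=
      ((hasDerivAt_re_trace_exp_smul_mul Z (Z * (U : Matrix (Fin 2) (Fin 2) ℂ)) t).neg).div_const 2
    have hcomp := hXd.mul ((hψ _).comp t hAd)
    refine hcomp.congr_of_eventuallyEq (Filter.Eventually.of_forall fun x => ?_)
    show su2x Z (expCurveSU Z hZ hZ0 x * U) * ψ (su2a0 (expCurveSU Z hZ hZ0 x * U)) = _
    rw [su2x, su2a0, hγU, ← Matrix.mul_assoc, hZexp]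
    rfl
  · -- derivative of S along the curve
    intro U t _
    have hAd : HasDerivAt (fun x : ℝ => ((exp (x • Z) * (U : Matrix (Fin 2) (Fin 2) ℂ)).trace).re / 2)
        ((((Z * exp (t • Z) * (U : Matrix (Fin 2) (Fin 2) ℂ)).trace).re) / 2) t :=
      (hasDerivAt_re_trace_exp_smul_mul Z (U : Matrix (Fin 2) (Fin 2) ℂ) t).div_const 2
    refine ((hAd.const_mul c).neg).congr_of_eventuallyEq (Filter.Eventually.of_forall fun x => ?_)
    show -(c * su2a0 (expCurveSU Z hZ hZ0 x * U)) = _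
    rw [su2a0, hγU]
    rfl
  · -- |h U| ≤ C
    intro U
    have hx : |su2x Z U| ≤ βZ / 2 := by
      rw [su2x, abs_div, abs_neg, abs_two]
      have := abs_re_trace_mul_le_of_mem_unitaryGroup (hVU 0 U) Z
      rw [zero_smul, NormedSpace.exp_zero, Matrix.one_mul, ← Matrix.trace_mul_comm] at this
      linarith
    rw [abs_mul]
    calc |su2x Z U| * |ψ (su2a0 U)| ≤ (βZ / 2) * K :=
          mul_le_mul hx (hK _) (abs_nonneg _) (by linarith)
      _ = 1 * K * (βZ / 2) := by ring
      _ ≤ C := hABC 1 K (βZ / 2) zero_le_one (by linarith) hK0 (by linarith) (by linarith)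
          (by linarith)
  · -- |S U| ≤ C
    intro U
    have ha : |su2a0 U| ≤ β1 / 2 := by
      rw [su2a0, abs_div, abs_two]
      have := bA 0 U
      rw [zero_smul, NormedSpace.exp_zero, Matrix.one_mul] at this
      linarith
    rw [abs_neg, abs_mul]
    calc |c| * |su2a0 U| ≤ |c| * (β1 / 2) := mul_le_mul_of_nonneg_left ha hc0
      _ = |c| * 1 * (β1 / 2) := by ring
      _ ≤ C := hABC |c| 1 (β1 / 2) hc0 (by linarith) zero_le_one (by linarith) (by linarith)
          (by linarith)
  · -- |Dh t U| ≤ C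
    intro U t _
    have h1 : |(-((Z * exp (t • Z) * (Z * (U : Matrix (Fin 2) (Fin 2) ℂ))).trace).re / 2)| ≤ β1 / 2 := by
      rw [hZexp, hZZU, Matrix.mul_neg, Matrix.trace_neg, Complex.neg_re, neg_neg, abs_div, abs_two]
      linarith [bA t U]
    have h2 : |(-((exp (t • Z) * (Z * (U : Matrix (Fin 2) (Fin 2) ℂ))).trace).re / 2)| ≤ βZ / 2 := by
      rw [abs_div, abs_neg, abs_two]; linarith [bX t U]
    have h3 : |(((Z * exp (t • Z) * (U : Matrix (Fin 2) (Fin 2) ℂ)).trace).re / 2)| ≤ βZ / 2 := by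
      rw [hZexp, abs_div, abs_two]; linarith [bX t U]
    calc _ ≤ |(-((Z * exp (t • Z) * (Z * (U : Matrix (Fin 2) (Fin 2) ℂ))).trace).re / 2)
              * ψ (((exp (t • Z) * (U : Matrix (Fin 2) (Fin 2) ℂ)).trace).re / 2)|
            + |(-((exp (t • Z) * (Z * (U : Matrix (Fin 2) (Fin 2) ℂ))).trace).re / 2)
              * (ψ' (((exp (t • Z) * (U : Matrix (Fin 2) (Fin 2) ℂ)).trace).re / 2)
                * (((Z * exp (t • Z) * (U : Matrix (Fin 2) (Fin 2) ℂ)).trace).re / 2))| := abs_add_le _ _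
      _ ≤ (β1 / 2) * K + (βZ / 2) * (K * (βZ / 2)) := by
            rw [abs_mul, abs_mul, abs_mul]
            exact add_le_add (mul_le_mul h1 (hK _) (abs_nonneg _) (by linarith))
              (mul_le_mul h2 (mul_le_mul (hK' _) h3 (abs_nonneg _) hK0) (by positivity) (by linarith))
      _ = 1 * K * (β1 / 2 + βZ * βZ / 4) := by ring
      _ ≤ C := hABC 1 K _ zero_le_one (by linarith) hK0 (by linarith) (by positivity) (by linarith)
  · -- |DS t U| ≤ C
    intro U t _
    have h3 : |(((Z * exp (t • Z) * (U : Matrix (Fin 2) (Fin 2) ℂ)).trace).re / 2)| ≤ βZ / 2 := by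
      rw [hZexp, abs_div, abs_two]; linarith [bX t U]
    rw [abs_neg, abs_mul]
    calc |c| * _ ≤ |c| * (βZ / 2) := mul_le_mul_of_nonneg_left h3 hc0
      _ = |c| * 1 * (βZ / 2) := by ring
      _ ≤ C := hABC |c| 1 (βZ / 2) hc0 (by linarith) zero_le_one (by linarith) (by linarith)
          (by linarith)

/-! ## §3 The `a₀` Stein identity -/

/-- Continuous real functions on SU(2) are Haar-integrable. -/
theorem integrable_of_continuous_SU2 {f : Matrix.specialUnitaryGroup (Fin 2) ℂ → ℝ}
    (hf : Continuous f) :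
    Integrable f (Literature.MathematicalPhysics.QuantumFieldTheory.haarProbability
      (Matrix.specialUnitaryGroup (Fin 2) ℂ)) :=
  hf.integrable_of_hasCompactSupport (HasCompactSupport.of_compactSpace f)

/-- **The `a₀` Stein identity of the SU(2) link law.**  For every real `c` (`= βk`) and every bounded
`C¹` test function `ψ` with bounded continuous derivative:
`∫ [ (1 − a₀²)(ψ′(a₀) + c ψ(a₀)) − 3 a₀ ψ(a₀) ] e^{c a₀} dHaar_SU(2)(U) = 0`. -/
theorem su2_a0_stein (c : ℝ) {ψ ψ' : ℝ → ℝ} (hψ : ∀ x, HasDerivAt ψ (ψ' x) x)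
    (hψ'c : Continuous ψ') {K : ℝ} (hK : ∀ x, |ψ x| ≤ K) (hK' : ∀ x, |ψ' x| ≤ K) :
    ∫ U, ((1 - su2a0 U ^ 2) * (ψ' (su2a0 U) + c * ψ (su2a0 U)) - 3 * su2a0 U * ψ (su2a0 U))
        * Real.exp (c * su2a0 U)
      ∂(Literature.MathematicalPhysics.QuantumFieldTheory.haarProbability
        (Matrix.specialUnitaryGroup (Fin 2) ℂ)) = 0 := by
  set μ := Literature.MathematicalPhysics.QuantumFieldTheory.haarProbability
    (Matrix.specialUnitaryGroup (Fin 2) ℂ)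
  have hψc : Continuous ψ := continuous_iff_continuousAt.mpr fun x => (hψ x).continuousAt
  have h1 := su2_generator_stein genZ1 genZ1_props.1 genZ1_props.2.1 genZ1_props.2.2 c hψ hψ'c hK hK'
  have h2 := su2_generator_stein genZ2 genZ2_props.1 genZ2_props.2.1 genZ2_props.2.2 c hψ hψ'c hK hK'
  have h3 := su2_generator_stein genZ3 genZ3_props.1 genZ3_props.2.1 genZ3_props.2.2 c hψ hψ'c hK hK'
  -- integrability of each generator integrand (continuous on a compact group)
  have ma0 : Continuous su2a0 := by
    unfold su2a0
    exact (Complex.continuous_re.comp (continuous_subtype_val.matrix_trace)).div_const _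
  have mx : ∀ Z : Matrix (Fin 2) (Fin 2) ℂ, Continuous (su2x Z) := fun Z => by
    unfold su2x
    exact ((Complex.continuous_re.comp ((continuous_const.matrix_mul
      continuous_subtype_val).matrix_trace)).neg).div_const _
  set T : Matrix (Fin 2) (Fin 2) ℂ → Matrix.specialUnitaryGroup (Fin 2) ℂ → ℝ := fun Z U =>
    (su2a0 U * ψ (su2a0 U) - su2x Z U ^ 2 * ψ' (su2a0 U) - c * su2x Z U ^ 2 * ψ (su2a0 U))
      * Real.exp (c * su2a0 U) with hT
  have hint : ∀ Z : Matrix (Fin 2) (Fin 2) ℂ, Integrable (T Z) μ := fun Z =>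
    integrable_of_continuous_SU2 ((((ma0.mul (hψc.comp ma0)).sub (((mx Z).pow 2).mul
      (hψ'c.comp ma0))).sub ((continuous_const.mul ((mx Z).pow 2)).mul (hψc.comp ma0))).mul
      (Real.continuous_exp.comp (continuous_const.mul ma0)))
  have h12 : Integrable (fun U => T genZ1 U + T genZ2 U) μ := (hint genZ1).add (hint genZ2)
  have hsum : ∫ U, (T genZ1 U + T genZ2 U + T genZ3 U) ∂μ = 0 := by
    have e1 : ∫ U, (T genZ1 U + T genZ2 U + T genZ3 U) ∂μ
        = ∫ U, (T genZ1 U + T genZ2 U) ∂μ + ∫ U, T genZ3 U ∂μ := integral_add h12 (hint genZ3)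
    have e2 : ∫ U, (T genZ1 U + T genZ2 U) ∂μ = ∫ U, T genZ1 U ∂μ + ∫ U, T genZ2 U ∂μ :=
      integral_add (hint genZ1) (hint genZ2)
    rw [e1, e2, h1, h2, h3, add_zero, add_zero]
  -- the target integrand is minus the sum (a₀² + Σ x_a² = 1)
  have hpt : ∀ U : Matrix.specialUnitaryGroup (Fin 2) ℂ,
      ((1 - su2a0 U ^ 2) * (ψ' (su2a0 U) + c * ψ (su2a0 U)) - 3 * su2a0 U * ψ (su2a0 U))
        * Real.exp (c * su2a0 U) = -(T genZ1 U + T genZ2 U + T genZ3 U) := by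
    intro U
    have hs := su2_sum_sq U
    have : 1 - su2a0 U ^ 2 = su2x genZ1 U ^ 2 + su2x genZ2 U ^ 2 + su2x genZ3 U ^ 2 := by linarith
    rw [this, hT]
    ring
  simp_rw [hpt, integral_neg, hsum, neg_zero]

/-- **`3 ⟨a₀⟩ = c ⟨1 − a₀²⟩`** under the SU(2) link law `e^{c a₀} dHaar` (`ψ = 1`): a reference-free,
histogram-free check of the heat bath's `a₀` step at every `βk`. -/
theorem su2_a0_mean (c : ℝ) :
    ∫ U, ((1 - su2a0 U ^ 2) * c - 3 * su2a0 U) * Real.exp (c * su2a0 U)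
      ∂(Literature.MathematicalPhysics.QuantumFieldTheory.haarProbability
        (Matrix.specialUnitaryGroup (Fin 2) ℂ)) = 0 := by
  have h := su2_a0_stein c (ψ := fun _ => 1) (ψ' := fun _ => 0) (K := 1)
    (fun x => hasDerivAt_const x 1) continuous_const (fun _ => by simp) (fun _ => by simp)
  simp only [zero_add, mul_one] at h
  exact h

end Summit.Ventures.LatticeQCDFlow.Exactness
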